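import Mathlib

/-!
# Stub `stub_gapped_corner` (crux `HiddenCorners`, stmt-MatrixMultiplication-7492, line `Sketch`)

The monomial corner of a gapped Toeplitz design.  The pencils are the 0/1 matrices
`T a b i j = [ρ i − γ j = α a + β b]` (rows indexed through `ρ`, columns through `γ`).
If the columns contain the frame positions `γ (f c) = h − β c` (`f` injective), the rows
contain the outputs `ρ (o a) = h + α a`, and no row index is a cross term
`h + α a + β b − β c` with `b ≠ c`, then with the unit-vector frames
`E j c = [j = f c]` and `F i a = [i = o a]` one has `(∑ X a b • T a b) * E = F * X` for every
`X`, and `rank E = r` (because `Eᵀ * E = 1`).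

Entry computation: `((∑ X a b • T a b) * E) i c = ∑ a b, X a b · [ρ i − γ (f c) = α a + β b]`;
the bracket is `[ρ i = h + α a + β b − β c]`, which vanishes for `b ≠ c` by the forbidden-row
hypothesis and equals `[ρ i = ρ (o a)] = [i = o a]` for `b = c` (injectivity of `ρ`), so the
entry is `∑ a, [i = o a] · X a c = (F * X) i c`.
-/

set_option linter.dupNamespace false

namespace Summit.MatrixMultiplication.MatrixMultiplication.Cruxes.HiddenCorners.Sketch

open scoped BigOperators Matrix

/-- A matrix whose columns are distinct standard basis vectors (`E j c = [j = f c]` with `f`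
injective) satisfies `Eᵀ * E = 1`. -/
private theorem unitCols_transpose_mul_self {N r : ℕ} (f : Fin r → Fin N)
    (hf : Function.Injective f) :
    (Matrix.of fun (j : Fin N) (c : Fin r) => if j = f c then (1 : ℂ) else 0)ᵀ *
        (Matrix.of fun (j : Fin N) (c : Fin r) => if j = f c then (1 : ℂ) else 0) = 1 := by
  ext c c'
  simp only [Matrix.mul_apply, Matrix.transpose_apply, Matrix.of_apply, ite_mul, one_mul,
    zero_mul, Finset.sum_ite_eq', Finset.mem_univ, if_true, Matrix.one_apply]
  by_cases hcc : c = c'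
  · simp [hcc]
  · simp [hcc, hf.ne hcc]

/-- A matrix whose columns are distinct standard basis vectors has full column rank. -/
private theorem rank_unitCols {N r : ℕ} (f : Fin r → Fin N) (hf : Function.Injective f) :
    (Matrix.of fun (j : Fin N) (c : Fin r) => if j = f c then (1 : ℂ) else 0).rank = r := by
  refine le_antisymm (Matrix.rank_le_width _) ?_
  have h1 := Matrix.rank_mul_le_right
    (Matrix.of fun (j : Fin N) (c : Fin r) => if j = f c then (1 : ℂ) else 0)ᵀ
    (Matrix.of fun (j : Fin N) (c : Fin r) => if j = f c then (1 : ℂ) else 0)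
  rw [unitCols_transpose_mul_self f hf, Matrix.rank_one, Fintype.card_fin] at h1
  exact h1

/-- STUB 3 — the monomial corner of a gapped design.  If the columns contain the frame positions
`γ (f c) = h − β c` (`f` injective), the rows contain the outputs `ρ (o a) = h + α a`, and no row index is a
cross term `h + α a + β b − β c` with `b ≠ c`, then `T(X) E = F X` for unit-vector frames `E` (rank `r`), `F`. -/
theorem stub_gapped_corner (r N : ℕ) (ρ γ : Fin N → ℤ) (α β : Fin r → ℤ) (h : ℤ)
    (f o : Fin r → Fin N) (hρ : Function.Injective ρ) (hf : Function.Injective f)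
    (hfγ : ∀ c, γ (f c) = h - β c) (hoρ : ∀ a, ρ (o a) = h + α a)
    (hforb : ∀ (i : Fin N) (a b c : Fin r), b ≠ c → ρ i ≠ h + α a + β b - β c) :
    ∃ E F : Matrix (Fin N) (Fin r) ℂ, E.rank = r ∧ ∀ X : Matrix (Fin r) (Fin r) ℂ,
      (∑ a : Fin r, ∑ b : Fin r,
          X a b • (Matrix.of fun i j : Fin N => if ρ i - γ j = α a + β b then (1 : ℂ) else 0)) * E
        = F * X := by
  refine ⟨Matrix.of fun (j : Fin N) (c : Fin r) => if j = f c then (1 : ℂ) else 0,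
    Matrix.of fun (i : Fin N) (a : Fin r) => if i = o a then (1 : ℂ) else 0,
    rank_unitCols f hf, ?_⟩
  intro X
  ext i c
  -- the bracket `[ρ i − γ (f c) = α a + β b]` is `[b = c ∧ i = o a]`
  have key : ∀ a b : Fin r, (ρ i - γ (f c) = α a + β b) ↔ (b = c ∧ i = o a) := by
    intro a b
    rw [hfγ c]
    constructor
    · intro hh
      have hbc : b = c := by
        by_contra hbc
        exact hforb i a b c hbc (by omega)
      subst hbc
      refine ⟨rfl, hρ ?_⟩
      rw [hoρ a]
      omega
    · rintro ⟨rfl, rfl⟩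
      rw [hoρ a]
      ring
  simp only [Matrix.mul_apply, Matrix.sum_apply, Matrix.smul_apply, Matrix.of_apply, smul_eq_mul,
    mul_ite, mul_one, mul_zero, ite_mul, one_mul, zero_mul, Finset.sum_ite_eq', Finset.mem_univ,
    if_true, key, ite_and]

end Summit.MatrixMultiplication.MatrixMultiplication.Cruxes.HiddenCorners.Sketch
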